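import Literature.AnabelianGeometry.SemiGraphs.ArithLevelKernelInner
import Literature.AnabelianGeometry.SemiGraphs.ArithTowerLevelStabilityJunction
import Literature.AnabelianGeometry.SemiGraphs.GaloisLevelDataChart
import Literature.AnabelianGeometry.SemiGraphs.TemperedResiduallyFiniteHolds
import Literature.AnabelianGeometry.SemiGraphs.ArithThm54CharCoresOfDesignData
import HarnessLib

/-!
# [SemiAnbd] Thm 5.4 (i) p. 66, producer T54-B: «hUρ» (`U_∞ ≤ ker ρ′`) at the chart of a cofinal Galois tower
# with CHARACTERISTIC finite levels — the inputs `hR`/`hnobp` of Corollary D discharged (proof-only)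

Mochizuki, *Semi-graphs of anabelioids*, Publ. RIMS **42** (2006), §3 Prop 3.6 (iii) p. 38 ("an injection
`π₁^temp(G) ↪ π̂₁(G)`"), Thm 3.7 (iii) p. 41, §5 Def 5.1 (i) p. 62, Thm 5.4 (i) p. 66
[cite: MochizukiSemiAnbd2006, Thm 5.4 (i) p.66]; Dixon–du Sautoy–Mann–Segal, *Analytic pro-p groups*,
Prop. 1.6 (characteristic open subgroups) [cite: DixonEtAl1999, Prop 1.6].

PROOF-ONLY (abc-iut cell, layer L3, row T54-B «char-tower hR/hnobp», L3-lead α97; seat abc-iut-w4-d085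
gen 5).  Corollary D of `ArithLevelKernelInner.lean`
(`ProfiniteSemiGraph.mem_ker_of_mem_iInf_map_ker_arithAct_outerAction`: at `E := π₁^temp(𝒢) ⋊^out Π_A`,
every `a ∈ U_∞ := ⋂ₙ aug (ker arithActₙ)` acts on `π₁^temp(𝒢)` by an INNER automorphism, `ρ′ a = 1`) has two
inputs beyond the tower data: residual finiteness of `π₁^temp(𝒢)` ALONG THE FINITE LEVELS (`hR`) and the
compact-subgroup test `hnobp`.  Here both are discharged at the chart `D.chart` of ANY cofinal Galois tower
`D` (abc-iut-L3-t9's `GaloisLevelData`, presentation `D.piPresentation T R` of abc-iut-L3-d4, finite levels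
`ker π_n`, tree levels `ker ρ_n`):

* `GaloisLevelData.eq_one_of_forall_mem_ker_piLevelAut_of_charOpenCore` — `hR` from [SemiAnbd] Prop 3.6 (iii)
  (`TemperedPiResiduallyFinite_holds`, kernel theorem) as soon as the finite levels are CHARACTERISTIC OPEN
  CORES, `ker π_n = charOpenCore π₁^temp (d n)` with `d` unbounded (the E1-junction currency `hker` of
  abc-iut-L3-t9 / the characteristic tower of abc-iut-w4-d048, where `d = id`): the open cores are cofinal
  among the open subgroups of finite index (`charOpenCore_le_of_finiteIndex`), which separate points;
* `GaloisLevelData.ofCharCores_eq_one_of_forall_mem_ker_piLevelAut` — `hR` AT abc-iut-w4-d048's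
  CHARACTERISTIC tower `GaloisLevelData.ofCharCores h36 v₀ hVt hEt` with NO residual input
  (`hker := ofCharCores_ker_piLevelAut_eq_charOpenCore`, abc-iut-w4-d029; `d = id`);
* `SemiGraph.SubgroupPresentation.eq_bot_of_isCompact_of_forall_deckAct_eq_one` — `hnobp` from the
  capstone binder `hnobpNCpt` (abc-iut-w4-d083/d053, a theorem at every tower with vertex-faithful levels)
  at ONE compatible branch-pair system of the finite coset levels (the system the (AI4″) binder
  `stabBranchPairAug` quantifies over): an element acting trivially on every finite level fixes every
  system;
* `GaloisLevelData.mem_ker_of_mem_iInf_map_ker_arithAct_chart_outerAction` — **«hUρ» at the chart of `D`**: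
  `U_∞ ≤ ker ρ′`, from `hker` and `hnobpNCpt` + one branch-pair system only; the tree-level inputs
  `hHK`/`hlift` (abc-iut-w4-d085, TemperedPiPresentationTowerInputs), `hKst ⟸ hLst` (abc-iut-L3-t9,
  `hKst_of_hLst_outerAction`), compactness of `H_w`, openness/antitonicity of `ker π_n`, first countability
  and exactness of `1 → π₁^temp → E → Π_A` are all theorems bound by name.

HONEST FRAME: along the modKernel route the (AI4″) producer's binder `hU` is ALREADY a theorem of tower data
(`hU_arithVertGp_outerAction`, ArithLevelKernelVertexLift.lean) and does not consume this file; «hUρ» is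
the sharper statement `U_∞ ≤ ker ρ′`, which genuinely needs a branch pair (at one-vertex edgeless data it
holds iff `ρ′ = 1`, abc-iut-w4-d071 `ArithLevelKernelEdgelessObstruction.lean`).  No definition, no new
named fact; nothing here refers to the IUT corpus; no side is taken on [IUTchIII] Cor 3.12; typed ≠ proved
for the inputs left as binders (`hP`, `hN`, `hker`, `hnobpNCpt`, the system).
-/

namespace Literature.AnabelianGeometry.SemiGraphs

open CategoryTheory Topology Filter
open scoped Pointwise

universe u v

/-! ### `hnobp` from the branch-pair test `hnobpNCpt` at one compatible system -/

namespace SemiGraph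

namespace SubgroupPresentation

variable {𝔾 : SemiGraph.{u}} {Γ : Type u} [Group Γ] [TopologicalSpace Γ]
  (P : SubgroupPresentation 𝔾 Γ)

/-- **`hnobp ⟸ hnobpNCpt` at one system.** If no compact subgroup `C ≠ 1` of `Γ` fixes, through the
arithmetic actions of `ι(C)`, a compatible system of a vertex with two distinct abutting branches of the
finite coset levels `L n` (the capstone binder `hnobpNCpt`), and ONE such compatible system
`(w, β, β′)_{i ≥ j₀}` is given, then every compact subgroup acting trivially on all finite levels is
trivial — the input `hnobp` of `deckAct_faithful_levels_of_forall_notMem` / Corollary D.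
[cite: MochizukiSemiAnbd2006, Thm 5.4 (i) p.66] -/
theorem eq_bot_of_isCompact_of_forall_deckAct_eq_one
    (L : ℕ → Subgroup Γ) [∀ n, (L n).Normal] (hLanti : ∀ ⦃i j : ℕ⦄, i ≤ j → L j ≤ L i)
    {E : Type v} [Group E] {Φ : E →* MulAut Γ} {σ : E →* Aut 𝔾} (hP : P.IsArithCompatible Φ σ)
    (hLst : ∀ (n : ℕ) (e : E) (x : Γ), x ∈ L n → Φ e x ∈ L n)
    (ι : Γ →* E) (hιΦ : ∀ g, Φ (ι g) = MulAut.conj g) (hισ : ∀ g, σ (ι g) = 1)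
    (hnobpNCpt : ∀ (C : Subgroup Γ), IsCompact (C : Set Γ) →
      ∀ (j₀ : ℕ) (w : ∀ i : {i : ℕ // j₀ ≤ i}, (P.cosetGraph (L i.1)).Vertex)
      (β β' : ∀ i : {i : ℕ // j₀ ≤ i}, (P.cosetGraph (L i.1)).Branch),
      (∀ i, β i ≠ β' i ∧ (P.cosetGraph (L i.1)).abuts (β i) = some (w i) ∧
        (P.cosetGraph (L i.1)).abuts (β' i) = some (w i)) →
      (∀ ⦃i i' : {i : ℕ // j₀ ≤ i}⦄ (h : i.1 ≤ i'.1),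
        (P.cosetGraphTrans (hLanti h)).vertexMap (w i') = w i ∧
        (P.cosetGraphTrans (hLanti h)).branchMap (β i') = β i ∧
          (P.cosetGraphTrans (hLanti h)).branchMap (β' i') = β' i) →
      (∀ (i : {i : ℕ // j₀ ≤ i}) (γ : C),
        (P.arithAct hP (L i.1) (hLst i.1) (ι γ)).hom.vertexMap (w i) = w i ∧
        (P.arithAct hP (L i.1) (hLst i.1) (ι γ)).hom.branchMap (β i) = β i ∧
          (P.arithAct hP (L i.1) (hLst i.1) (ι γ)).hom.branchMap (β' i) = β' i) →
        C = ⊥)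
    (j₀ : ℕ) (w : ∀ i : {i : ℕ // j₀ ≤ i}, (P.cosetGraph (L i.1)).Vertex)
    (β β' : ∀ i : {i : ℕ // j₀ ≤ i}, (P.cosetGraph (L i.1)).Branch)
    (hpair : ∀ i, β i ≠ β' i ∧ (P.cosetGraph (L i.1)).abuts (β i) = some (w i) ∧
      (P.cosetGraph (L i.1)).abuts (β' i) = some (w i))
    (hcompat : ∀ ⦃i i' : {i : ℕ // j₀ ≤ i}⦄ (h : i.1 ≤ i'.1),
      (P.cosetGraphTrans (hLanti h)).vertexMap (w i') = w i ∧
      (P.cosetGraphTrans (hLanti h)).branchMap (β i') = β i ∧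
        (P.cosetGraphTrans (hLanti h)).branchMap (β' i') = β' i) :
    ∀ C : Subgroup Γ, IsCompact (C : Set Γ) → (∀ n (t : C), P.deckAct (L n) (t : Γ) = 1) → C = ⊥ := by
  intro C hC htriv
  refine hnobpNCpt C hC j₀ w β β' hpair hcompat fun i γ => ?_
  rw [P.arithAct_eq_deckAct_of_inner hP (L i.1) (hLst i.1) (hιΦ (γ : Γ)) (hισ (γ : Γ)), htriv i.1 γ]
  exact ⟨rfl, rfl, rfl⟩

end SubgroupPresentation

end SemiGraph

namespace ProfiniteSemiGraph

namespace GaloisLevelData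

open Literature.AnabelianGeometry.EtaleTheta
open Literature.AnabelianGeometry.AbsoluteAnabelian (IsTopologicallyFinitelyGenerated)

variable {𝒢 : ProfiniteSemiGraph.{u}} (D : GaloisLevelData 𝒢) (h𝒢 : 𝒢.IsCountable)
  (hcof : ∀ (T : CovObj 𝒢), T.IsTempered → ∀ p : T.Point,
    ∃ i : ℕ, ∀ j, i ≤ j → (D.S j).Splits (T.component p))
  (hcn : 𝒢.graph.IsConnected) (hS : ∀ n, (D.S n).Splits (D.S n)) (hfin : ∀ n, (D.S n).IsFinite)
  (hne : ∀ n, (D.S n).HasNonemptyFibres)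
  (hconn : ∀ (n : ℕ) (p q : (D.S n).Point), (D.S n).SameComponent p q)

/-! ### `hR`: residual finiteness along CHARACTERISTIC finite levels ([SemiAnbd] Prop 3.6 (iii)) -/

include hcof hcn hS hfin hne in
/-- **`hR` at a tower with characteristic finite levels.** If the finite-level kernels of the tower are
characteristic open cores, `ker π_n = charOpenCore π₁^temp (d n)` with `d` unbounded, then an element of
`π₁^temp(𝒢)` lying in EVERY `ker π_n` is `1`: the open cores lie below every open subgroup of finite index
(`charOpenCore_le_of_finiteIndex`), and those separate the points of `π₁^temp(𝒢)` by [SemiAnbd] Prop 3.6 (iii)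
(`TemperedPiResiduallyFinite_holds`, at the chart `D.chart` of the tower).
[cite: MochizukiSemiAnbd2006, Prop 3.6 (iii) p.38] -/
theorem eq_one_of_forall_mem_ker_piLevelAut_of_charOpenCore (h36 : 𝒢.Prop36Hypotheses)
    (d : ℕ → ℕ) (hker : ∀ n, (D.piLevelAut h𝒢 hconn n).ker = charOpenCore (D.temperedPi h𝒢) (d n))
    (hd : ∀ m : ℕ, ∃ n, m ≤ d n) (g : D.temperedPi h𝒢) (hg : ∀ n, g ∈ (D.piLevelAut h𝒢 hconn n).ker) :
    g = 1 := by
  by_contra hg1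
  obtain ⟨N, hNfin, hgN⟩ :=
    TemperedPiResiduallyFinite_holds 𝒢 h36 (D.chart h𝒢 hcof hcn hS hfin hne) g hg1
  haveI := hNfin
  haveI : N.toSubgroup.FiniteIndex := Subgroup.finiteIndex_of_finite_quotient
  obtain ⟨n, hn⟩ := hd N.toSubgroup.index
  have hgn : g ∈ charOpenCore (D.temperedPi h𝒢) (d n) := hker n ▸ hg n
  exact hgN (charOpenCore_le_of_finiteIndex N.toSubgroup N.isOpen (charOpenCore_anti hn hgn))

/-- **`hR` at the CHARACTERISTIC tower, no residual input**: for a finite semi-graph of anabelioids with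
topologically finitely generated constituents satisfying the hypotheses of Prop 3.6, an element of the
tempered group of abc-iut-w4-d048's characteristic tower `GaloisLevelData.ofCharCores h36 v₀ hVt hEt` lying in
every finite-level kernel `ker π_k` (`= charOpenCore _ k`, abc-iut-w4-d029's
`ofCharCores_ker_piLevelAut_eq_charOpenCore`) is `1` ([SemiAnbd] Prop 3.6 (iii)).
[cite: MochizukiSemiAnbd2006, Prop 3.6 (iii) p.38] -/
theorem ofCharCores_eq_one_of_forall_mem_ker_piLevelAut [Finite 𝒢.graph.Vertex] [Finite 𝒢.graph.Branch]
    (h36 : 𝒢.Prop36Hypotheses) (v₀ : 𝒢.graph.Vertex)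
    (hVt : ∀ v : 𝒢.graph.Vertex, IsTopologicallyFinitelyGenerated (𝒢.Gv v))
    (hEt : ∀ e : 𝒢.graph.Edge, IsTopologicallyFinitelyGenerated (𝒢.Ge e))
    (g : (GaloisLevelData.ofCharCores h36 v₀ hVt hEt).temperedPi h36.isCountable)
    (hg : ∀ k, g ∈ ((GaloisLevelData.ofCharCores h36 v₀ hVt hEt).piLevelAut h36.isCountable
      (ofCharCores_sameComponent h36 v₀ hVt hEt) k).ker) : g = 1 :=
  (GaloisLevelData.ofCharCores h36 v₀ hVt hEt).eq_one_of_forall_mem_ker_piLevelAut_of_charOpenCore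
    h36.isCountable (ofCharCores_exists_level_splits_component h36 v₀ hVt hEt) h36.isConnected
    (ofCharCores_splits_self h36 v₀ hVt hEt) (ofCharCores_isFinite h36 v₀ hVt hEt)
    (ofCharCores_hasNonemptyFibres h36 v₀ hVt hEt) (ofCharCores_sameComponent h36 v₀ hVt hEt) h36
    (fun k : ℕ => k) (ofCharCores_ker_piLevelAut_eq_charOpenCore h36 v₀ hVt hEt) (fun m => ⟨m, le_rfl⟩) g hg

/-! ### Corollary D at the chart of the tower -/

variable (T : ∀ w : 𝒢.graph.Vertex, D.PointSeq h𝒢 w) (R : SemiGraph.RefBranches 𝒢.graph)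

/-- **«hUρ» at the chart of a cofinal Galois tower with characteristic finite levels** — Corollary D of
`ArithLevelKernelInner.lean` with `hR` and `hnobp` DISCHARGED: at `E := π₁^temp(𝒢) ⋊^out_{ρ′} Π_A` over the
chart `D.chart` of the tower `D`, for the presentation `D.piPresentation T R` with finite levels `ker π_n`
(Φ-stable, `hN`) that are characteristic open cores (`hker`, `d` unbounded), given the branch-pair test
`hnobpNCpt` and ONE compatible system `(w, β, β′)_{i ≥ j₀}` of a vertex with two distinct abutting branches
of the finite coset levels, every `a ∈ Π_A` admitting at every finite level a lift acting trivially on that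
level (`a ∈ U_∞ = ⋂ₙ aug (ker arithActₙ)`) has `ρ′ a = 1`.  Tree-level inputs `hHK`/`hlift`, `hKst ⟸ hN`,
compactness of the vertex groups, first countability, exactness: theorems bound by name.
[cite: MochizukiSemiAnbd2006, Thm 5.4 (i) p.66] -/
theorem mem_ker_of_mem_iInf_map_ker_arithAct_chart_outerAction (h36 : 𝒢.Prop36Hypotheses)
    {PA : Type u} [Group PA] (ρ' : PA →* TopOut (D.chart h𝒢 hcof hcn hS hfin hne).G)
    (baseAct : PA →* Aut 𝒢.graph)
    (hP : (D.piPresentation h𝒢 T R).IsArithCompatible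
      (((contMulAut (D.chart h𝒢 hcof hcn hS hfin hne).G).subtype.comp
        (MonoidHom.fst (contMulAut (D.chart h𝒢 hcof hcn hS hfin hne).G) PA)).comp
          (outerSemidirectProduct ρ').subtype)
      (baseAct.comp (outerSemidirectProductSnd ρ')))
    (hN : ∀ (n : ℕ) (e : outerSemidirectProduct ρ') (x : (D.chart h𝒢 hcof hcn hS hfin hne).G),
      x ∈ (D.piLevelAut h𝒢 hconn n).ker →
        (((contMulAut (D.chart h𝒢 hcof hcn hS hfin hne).G).subtype.comp
          (MonoidHom.fst (contMulAut (D.chart h𝒢 hcof hcn hS hfin hne).G) PA)).comp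
            (outerSemidirectProduct ρ').subtype) e x ∈ (D.piLevelAut h𝒢 hconn n).ker)
    -- CHARACTERISTIC finite levels (abc-iut-L3-t9 E1 currency): `ker π_n = charOpenCore π₁^temp (d n)`
    (d : ℕ → ℕ) (hker : ∀ n, (D.piLevelAut h𝒢 hconn n).ker = charOpenCore (D.temperedPi h𝒢) (d n))
    (hd : ∀ m : ℕ, ∃ n, m ≤ d n)
    -- the capstone binder `hnobpNCpt` (abc-iut-w4-d083/d053: a theorem at every vertex-faithful tower)
    (hnobpNCpt : ∀ (C : Subgroup (D.chart h𝒢 hcof hcn hS hfin hne).G),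
      IsCompact (C : Set (D.chart h𝒢 hcof hcn hS hfin hne).G) →
      ∀ (j₀ : ℕ) (w : ∀ i : {i : ℕ // j₀ ≤ i},
        ((D.piPresentation h𝒢 T R).cosetGraph (D.piLevelAut h𝒢 hconn i.1).ker).Vertex)
      (β β' : ∀ i : {i : ℕ // j₀ ≤ i},
        ((D.piPresentation h𝒢 T R).cosetGraph (D.piLevelAut h𝒢 hconn i.1).ker).Branch),
      (∀ i, β i ≠ β' i ∧
        ((D.piPresentation h𝒢 T R).cosetGraph (D.piLevelAut h𝒢 hconn i.1).ker).abuts (β i) = some (w i) ∧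
        ((D.piPresentation h𝒢 T R).cosetGraph (D.piLevelAut h𝒢 hconn i.1).ker).abuts (β' i) =
          some (w i)) →
      (∀ ⦃i i' : {i : ℕ // j₀ ≤ i}⦄ (h : i.1 ≤ i'.1),
        ((D.piPresentation h𝒢 T R).cosetGraphTrans (D.ker_piLevelAut_anti h𝒢 hconn h)).vertexMap (w i') =
          w i ∧
        ((D.piPresentation h𝒢 T R).cosetGraphTrans (D.ker_piLevelAut_anti h𝒢 hconn h)).branchMap (β i') =
          β i ∧
        ((D.piPresentation h𝒢 T R).cosetGraphTrans (D.ker_piLevelAut_anti h𝒢 hconn h)).branchMap (β' i') =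
          β' i) →
      (∀ (i : {i : ℕ // j₀ ≤ i}) (γ : C),
        ((D.piPresentation h𝒢 T R).arithAct hP (D.piLevelAut h𝒢 hconn i.1).ker (hN i.1)
            ((toOuterSemidirectProduct ρ') γ)).hom.vertexMap (w i) = w i ∧
        ((D.piPresentation h𝒢 T R).arithAct hP (D.piLevelAut h𝒢 hconn i.1).ker (hN i.1)
            ((toOuterSemidirectProduct ρ') γ)).hom.branchMap (β i) = β i ∧
        ((D.piPresentation h𝒢 T R).arithAct hP (D.piLevelAut h𝒢 hconn i.1).ker (hN i.1)
            ((toOuterSemidirectProduct ρ') γ)).hom.branchMap (β' i) = β' i) →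
        C = ⊥)
    -- ONE compatible branch-pair system of the finite coset levels
    (j₀ : ℕ) (w : ∀ i : {i : ℕ // j₀ ≤ i},
      ((D.piPresentation h𝒢 T R).cosetGraph (D.piLevelAut h𝒢 hconn i.1).ker).Vertex)
    (β β' : ∀ i : {i : ℕ // j₀ ≤ i},
      ((D.piPresentation h𝒢 T R).cosetGraph (D.piLevelAut h𝒢 hconn i.1).ker).Branch)
    (hpair : ∀ i, β i ≠ β' i ∧
      ((D.piPresentation h𝒢 T R).cosetGraph (D.piLevelAut h𝒢 hconn i.1).ker).abuts (β i) = some (w i) ∧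
      ((D.piPresentation h𝒢 T R).cosetGraph (D.piLevelAut h𝒢 hconn i.1).ker).abuts (β' i) = some (w i))
    (hcompat : ∀ ⦃i i' : {i : ℕ // j₀ ≤ i}⦄ (h : i.1 ≤ i'.1),
      ((D.piPresentation h𝒢 T R).cosetGraphTrans (D.ker_piLevelAut_anti h𝒢 hconn h)).vertexMap (w i') =
        w i ∧
      ((D.piPresentation h𝒢 T R).cosetGraphTrans (D.ker_piLevelAut_anti h𝒢 hconn h)).branchMap (β i') =
        β i ∧
      ((D.piPresentation h𝒢 T R).cosetGraphTrans (D.ker_piLevelAut_anti h𝒢 hconn h)).branchMap (β' i') =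
        β' i)
    {a : PA} (ha : ∀ n, a ∈ (((D.piPresentation h𝒢 T R).arithAct hP (D.piLevelAut h𝒢 hconn n).ker
      (hN n)).ker).map (outerSemidirectProductSnd ρ')) :
    a ∈ ρ'.ker := by
  haveI : T2Space (D.chart h𝒢 hcof hcn hS hfin hne).G := D.t2Space_temperedPi h𝒢
  haveI : FirstCountableTopology (D.chart h𝒢 hcof hcn hS hfin hne).G := by
    haveI := (D.chart h𝒢 hcof hcn hS hfin hne).secondCountableTopology
    infer_instance
  -- the `Normal` families, stated AT THE CHART TYPE (instance resolution does not unfold `D.chart`)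
  haveI hKn : ∀ m : ℕ, @Subgroup.Normal (D.chart h𝒢 hcof hcn hS hfin hne).G
      (D.chart h𝒢 hcof hcn hS hfin hne).group ((D.projAut h𝒢 m).ker) := fun _ => MonoidHom.normal_ker _
  haveI hLn : ∀ n : ℕ, @Subgroup.Normal (D.chart h𝒢 hcof hcn hS hfin hne).G
      (D.chart h𝒢 hcof hcn hS hfin hne).group ((D.piLevelAut h𝒢 hconn n).ker) :=
    fun _ => MonoidHom.normal_ker _
  have hex : (toOuterSemidirectProduct ρ').range = (outerSemidirectProductSnd ρ').ker :=
    range_toOuterSemidirectProduct_eq_ker ρ'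
  have hισ : ∀ g : (D.chart h𝒢 hcof hcn hS hfin hne).G,
      (baseAct.comp (outerSemidirectProductSnd ρ')) ((toOuterSemidirectProduct ρ') g) = 1 := fun g => by
    have hg : (toOuterSemidirectProduct ρ') g ∈ (outerSemidirectProductSnd ρ').ker := hex ▸ ⟨g, rfl⟩
    rw [MonoidHom.comp_apply, (MonoidHom.mem_ker).mp hg, map_one]
  have hnobp := (D.piPresentation h𝒢 T R).eq_bot_of_isCompact_of_forall_deckAct_eq_one
    (fun n => (D.piLevelAut h𝒢 hconn n).ker) (D.ker_piLevelAut_anti h𝒢 hconn) hP hN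
    (toOuterSemidirectProduct ρ') (fun _ => rfl) hισ hnobpNCpt j₀ w β β' hpair hcompat
  exact mem_ker_of_mem_iInf_map_ker_arithAct_outerAction (D.chart h𝒢 hcof hcn hS hfin hne) ρ' baseAct
    (D.piPresentation h𝒢 T R) hP hex
    (fun m => (D.projAut h𝒢 m).ker) (D.ker_projAut_anti h𝒢)
    (D.hKst_of_hLst_outerAction h𝒢 hconn T R ρ' hP hN)
    (D.piPresentation_hHK h𝒢 T R) (D.piPresentation_hlift h𝒢 T R)
    (fun n => (D.piLevelAut h𝒢 hconn n).ker) hN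
    (D.ker_projAut_le_ker_piLevelAut h𝒢 hconn) (D.isOpen_ker_piLevelAut h𝒢 hconn)
    (D.ker_piLevelAut_anti h𝒢 hconn)
    (w ⟨j₀, le_rfl⟩).1 (D.isCompact_piPresentation_H h𝒢 T R)
    (D.eq_one_of_forall_mem_ker_piLevelAut_of_charOpenCore h𝒢 hcof hcn hS hfin hne hconn h36 d hker hd)
    hnobp ha

end GaloisLevelData

end ProfiniteSemiGraph

end Literature.AnabelianGeometry.SemiGraphs
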